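import Literature.MathematicalPhysics.QuantumFieldTheory.Balaban1983to89.B8SpecialUnitaryTrace
import Literature.MathematicalPhysics.QuantumFieldTheory.Balaban1983to89.B13Inv214OrbitSUN

/-!
# `Balaban1983to89.B8SpecialLinearTrace` — [Balaban1985RegularSpaces] p. 76 / [Balaban1985Averaging] p. 20 for `G = SU(N)`: the complexified
# group `H = SL(N, ℂ)` carries (H2) «`tr log h = 0` near `1`» and (H3) «`e^{S} ∈ SL(N, ℂ)` for trace-free `S`», and `SU(N)` is averaging-closed
# for `N ≤ 12` (sub-row «G-B8-T2S», JOINT J-SU layer 3c: the `M_N(ℂ)` instances of the hypotheses of `B8SectERemainderTraceFree`)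

statement-level skeleton of published theorems with citation tags; proofs where landed; nothing here is a claim about the
Yang–Mills mass gap

T. Bałaban, *Averaging operations for lattice gauge theories*, Commun. Math. Phys. **98** (1985) 17–51 `[Balaban1985Averaging]` ("[3]"), p. 20
(«the group `G` is obtained by applying the function `e^{iA}` to `A ∈ 𝔤`»), (19)–(23) p. 21, (42)–(43) pp. 23–24; T. Bałaban, *Spaces of regular
gauge field configurations …*, Commun. Math. Phys. **99** (1985) 75–102 `[Balaban1985RegularSpaces]` ("B8"), p. 76.  STATUS: published, refereed.

CITATION HEADER (lean-in-tree rule).  Cell `lit-balaban`, seat `lit-balaban-t2s-1` (gen 0), sub-row «G-B8-T2S» (R3 `stmt-QuantumFields-19200`),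
JOINT J-SU layer 3c (`lit-balaban-t2s-1/J-SU-ROADMAP.md`).  WHAT IS REPRODUCED.  `B8SectERemainderTraceFree.apply_Cnl_inv_of_axial` (the binder
`hCτ` of `B8SectETraceFree` as a theorem) is parametrised by subgroups `G ≤ H` of `𝔸ˣ` with `G` averaging-closed and `G ≤ U(𝔸)`, (H2)
`τ(log h) = 0` for `h ∈ H`, `‖h − 1‖ ≤ ⅛`, (H3) `e^{S} ∈ H` for `τ`-free `S`.  THIS FILE gives the `M_N(ℂ)` instances (operator norm of the scope
`Matrix.Norms.L2Operator`; `τ = B8SpecialUnitaryTrace.trCLM`; `G = specialUnitaryUnits (Fin N)`; `H = B13Inv214OrbitSUN.slUnits N = SL(N, ℂ)`, REUSED):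
* `specialUnitaryUnits_le_slUnits` (`SU(N) ≤ SL(N, ℂ)`);
* (H2) `trCLM_mlog_eq_zero_of_mem_slUnits` — for `N ≤ 25` (`= ExpMeanLog.trace_mlog_eq_zero_of_det_eq_one`: `e^{tr log h} = det h = 1`, `|tr log h| ≤ 2N‖h − 1‖ < 2π`);
* (H3) `expUnit_mem_slUnits` (Liouville `det e^{S} = e^{tr S}`, `Literature.Analysis.Matrix.det_exp_eq_exp_trace`);
* `avgClosed_specialUnitary` — `AvgClosed d L (SU(N))` for `1 ≤ N ≤ 12` (`B7Prop2SpecialUnitary.avgClosedAt_specialUnitary` at `t = ¼`, `N/4 < π`;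
  the `N`-window cannot be dropped, loc. cit. §5).

HONEST SCOPE.  Finite-dimensional linear algebra; no new analysis.  Count-neutral; N05 ∕ `stub_PV3A` NOT discharged; nothing continuum ∕ ℝ⁴ ∕ OS ∕
mass-gap ∕ Clay.  No `sorry`, no `def`, no `… : Prop` fact, no `instance` (`letI` of the scoped C⋆-structure inside proofs), no `notation`.
-/

noncomputable section

open scoped Matrix.Norms.L2Operator
open NormedSpace

namespace Literature.MathematicalPhysics.QuantumFieldTheory.Balaban1983to89.B8SpecialLinearTrace

open MatrixLog (mlog)
open B7Prop1Explicit (expUnit val_expUnit)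
open B7Prop2Explicit (AvgClosed)
open B7Prop2SpecialUnitary (specialUnitaryUnits mem_specialUnitaryUnits avgClosedAt_specialUnitary)
open B13Inv214OrbitSUN (slUnits mem_slUnits_iff)
open B8SpecialUnitaryTrace (trCLM trCLM_apply)

variable {N : ℕ}

/-- `SU(N) ≤ SL(N, ℂ)`. [cite: Balaban1985Averaging, p.20] -/
theorem specialUnitaryUnits_le_slUnits : specialUnitaryUnits (Fin N) ≤ slUnits N := fun _ hg =>
  mem_slUnits_iff.2 (Matrix.mem_specialUnitaryGroup_iff.1 (mem_specialUnitaryUnits.1 hg)).2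

/-- **(H2) for `SL(N, ℂ)`, `N ≤ 25`**: `tr log h = 0` for `det h = 1`, `‖h − 1‖ ≤ ⅛` (`e^{tr log h} = det e^{log h} = det h = 1` and
`|tr log h| ≤ N‖log h‖ ≤ 2N‖h − 1‖ ≤ N/4 < 2π`; `ExpMeanLog.trace_mlog_eq_zero_of_det_eq_one`). [cite: Balaban1985Averaging, (20)–(23) p.21, p.20] -/
theorem trCLM_mlog_eq_zero_of_mem_slUnits (hN : N ≤ 25) {g : (Matrix (Fin N) (Fin N) ℂ)ˣ} (hg : g ∈ slUnits N)
    (hs : ‖(g : Matrix (Fin N) (Fin N) ℂ) - 1‖ ≤ 1 / 8) :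
    trCLM (Fin N) (mlog (g : Matrix (Fin N) (Fin N) ℂ)) = 0 := by
  rw [trCLM_apply]
  refine ExpMeanLog.trace_mlog_eq_zero_of_det_eq_one (mem_slUnits_iff.1 hg) (hs.trans (by norm_num)) ?_
  have hN' : (Fintype.card (Fin N) : ℝ) ≤ 25 := by rw [Fintype.card_fin]; exact_mod_cast hN
  have hπ := Real.pi_gt_d2
  calc (Fintype.card (Fin N) : ℝ) * ‖(g : Matrix (Fin N) (Fin N) ℂ) - 1‖ ≤ 25 * (1 / 8) :=
        mul_le_mul hN' hs (norm_nonneg _) (by norm_num)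
    _ < Real.pi := by norm_num at hπ ⊢; linarith

/-- **(H3) for `SL(N, ℂ)`**: `e^{S} ∈ SL(N, ℂ)` for trace-free `S` (Liouville). [cite: Balaban1985Averaging, p.20] -/
theorem expUnit_mem_slUnits {S : Matrix (Fin N) (Fin N) ℂ} (htr : trCLM (Fin N) S = 0) : expUnit S ∈ slUnits N := by
  letI : CStarAlgebra (Matrix (Fin N) (Fin N) ℂ) := {}
  rw [mem_slUnits_iff, val_expUnit, Literature.Analysis.Matrix.det_exp_eq_exp_trace, ← trCLM_apply, htr, exp_zero]

/-- **`SU(N)` is averaging-closed (radius ¼) for `1 ≤ N ≤ 12`** (`N/4 < π`; `B7Prop2SpecialUnitary.avgClosedAt_specialUnitary`).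
[cite: Balaban1985Averaging, (42)–(43) pp.23–24, p.20] -/
theorem avgClosed_specialUnitary (d L : ℕ) [NeZero N] (hN : N ≤ 12) : AvgClosed d L (specialUnitaryUnits (Fin N)) := by
  letI : CStarAlgebra (Matrix (Fin N) (Fin N) ℂ) := {}
  have hπ := Real.pi_gt_three
  have hN' : (Fintype.card (Fin N) : ℝ) ≤ 12 := by rw [Fintype.card_fin]; exact_mod_cast hN
  refine (avgClosedAt_specialUnitary d L (t := 1 / 4) le_rfl ?_).avgClosed le_rfl
  calc (Fintype.card (Fin N) : ℝ) * (1 / 4) ≤ 12 * (1 / 4) := mul_le_mul_of_nonneg_right hN' (by norm_num)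
    _ < Real.pi := by linarith

#print axioms trCLM_mlog_eq_zero_of_mem_slUnits
#print axioms avgClosed_specialUnitary

end Literature.MathematicalPhysics.QuantumFieldTheory.Balaban1983to89.B8SpecialLinearTrace

end
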